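import Literature.NumberTheory.EllipticCurves.Sprung2012.SharpFlatSelmerDualExistsProofs
import Literature.NumberTheory.EllipticCurves.Sprung2012.ColemanMapTheorems
import Literature.NumberTheory.EllipticCurves.GaloisAction
import HarnessLib

/-!
# Sprung 2012, Theorem 1.2 = 7.14 (`η = 1`) and Theorem 1.4 = 7.16 (`η = 1`): for the colour `•`
# with `L^•_p(E, X) ≠ 0`, `X^•(E/ℚ_∞)` is finitely generated `Λ`-torsion, and the Kato-side
# inclusion `Char X^•(E/ℚ_∞) ⊇ (pⁿ L^•_p(E, X))` (`n = 0` under `GL_{ℤ_p}(T)`-surjectivity) — named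
# facts on the REAL objects of `Sprung2012/SharpFlatSelmer.lean`

Topic `Literature/NumberTheory/EllipticCurves`, cluster `Sprung2012` (namespace = path). Sibling of
`ColemanMaps.lean` / `ColemanMapTheorems.lean` / `SharpFlatSelmer.lean` /
`SharpFlatSelmerDualExistsProofs.lean` (cell `bsd-ssimc`, seat `bsd-ssimc-k3c5-kdot-split`: Sprung's
pairings `P_{n,x}`, Honda systems, the Coleman characterisation `IsColemanPair`, `Ker Col^•`, the local
condition `E^•_{∞,𝔭}`, `Sel^•(E/K_∞)` and the Pontryagin-dual hypothesis structure
`SharpFlatSelmerDualData W κ γ ι ap g c •` with `charIdeal`, in the `η = 1` / `ℤ_p`-tower form) and the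
♯/♭ twin of `Kobayashi2003/SignedKatoDivisibility.lean` (`thm41_signedCharIdeal_divisibility`, the
`a_p = 0` case, where ♯ = Kobayashi's `−` and ♭ = Kobayashi's `+`). TWO published theorems of
F. E. I. Sprung, *Iwasawa theory for elliptic curves at supersingular primes: A pair of main
conjectures*, J. Number Theory **132** (2012) 1483–1506 [Sprung2012] are vendored as NAMED FACTS
(`def … : Prop`, nothing asserted, no `_holds`; D-0014): Theorem 1.2 (= Theorem 7.14 at the trivial
tame character) and Theorem 1.4 / Theorem 7.16 (at the trivial tame character); everything else is a
proved consequence. HONEST FRAMING (cross-ladder LITERATURE-TYPING layer D-0088(4), cell `bsd-littype`,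
seat `bsd-littype-11`; consumers: route K3 `SignedLowerHalves`, crux `SprungLowerHalfAtThree` =
stmt-BirchSwinnertonDyer-19003, whose Kato half at `(3, a_3 = ±3)` is at present priced at the
BSD_p level by `Sprung2024.cor12_padicValRat_bsd_rank_zero_le` / `cor13_…`): net debt +2; nothing
about any curve is asserted, no census cell moves, BSD is not proved by any of this. Typed ≠ proved ≠
endorsed.

## The printed statements (held text `paper:doi-10-1016-j-jnt-2011-11-003`, chunk `p00NN` = printed
## page 1482+NN; the ♯/♭ glyphs and the sign «≠» are LOST in that text layer — every quotation below
## was checked against the clean-glyph TeX of the same author: arXiv:0903.3419v1 (the θ/υ draft of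
## this paper, `paper:arxiv-0903.3419` p0010 L66–L75, p0011 L12–L18) and J. reine angew. Math. 681
## (2013) = arXiv:1106.1936 (`paper:arxiv-1106.1936` p0003 L22–L26, p0006 L17–L19))

§1, p. 1486 (the `η = 1` statements; "Let `𝔭` be the prime ideal of `ℚ_∞` above `p` …"; "The
statements here correspond to the `η = 1` case in the more precise statements of Section 7"):

* **Theorem 1.2.** "Choose `∗ ∈ {♯, ♭}` so that `L^∗_p(E, X)` is nonzero. The Pontryagin dual
  `X^∗(E/ℚ_∞) = Hom(Sel^∗(E/ℚ_∞), ℚ_p/ℤ_p)` of this `∗`-Selmer group is a finitely generated torsion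
  `ℤ_p[[X]]`-module." (preceded by: "Now at least one of `L♯_p(E, X)` and `L♭_p(E, X)` is nonzero,
  and conjecturally both are" — Prop. 6.14 / Conj. 6.15; the first sentence is the tree theorem
  `Sprung2017.IsSprungPair.ne_zero_or_ne_zero`.)
* **Main Conjecture 1.3.** "Let `p` be odd, and `∗ ∈ {♯, ♭}` so that `L^∗_p(E, X)` is nonzero. The
  characteristic ideal of the Pontryagin dual of `Sel^∗(E/ℚ_∞)` is then generated by the `p`-adic
  `L`-function `L^∗_p(E, X)`: `Char(X^∗(E/ℚ_∞)) = (L^∗_p(E, X))`." — a CONJECTURE: NOT vendored here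
  (conjectures are Summits-side obligations; the route displays its Eisenstein half on a datum).
* **Theorem 1.4.** "Suppose `E/ℚ` does not have complex multiplication. Choose `∗ ∈ {♯, ♭}` so that
  `L^∗_p(E, X)` is nonzero. Then if the `p`-adic representation `Gal(ℚ̄/ℚ) → GL_{ℤ_p}(T)` on the
  automorphism group of the `p`-adic Tate module `T` is surjective, we have
  `Char(X^∗(E/ℚ_∞)) ⊇ (L^∗_p(E, X))`."

§7.2, p. 1504 (the `η`-component statements over `K_∞ = ℚ(ζ_{p^∞})`, `Λ = ℤ_p[Δ][[X]]`):

* **Theorem 7.14.** "Let `p` be an odd supersingular prime, `η : Δ → ℤ_p^×` be a character, and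
  `∗ ∈ {♯, ♭}` be chosen so that `L^∗_p(E, η, X) ≠ 0`. Then `X^∗(E/K_∞)^η` is `ℤ_p[[X]]`-torsion."
  (proof: exact sequence (3) from [Kobayashi, Prop. 7.1, Thm. 7.3 i]; `X^0` torsion, Cor. 7.2.)
* **Theorem 7.16.** "Let `p` be an odd supersingular prime, and `∗ ∈ {♯, ♭}` so that
  `L^∗_p(E, η, X) ≠ 0`. Then for some integer `n ⩾ 0`,
  `Char X^∗(E/K_∞)^η ⊇ (pⁿ (1/X) L^∗_p(E, η, X))` if `∗ = ♯`, `η ≠ 1`, and `a_p = 0`,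
  `Char X^∗(E/K_∞)^η ⊇ (pⁿ L^∗_p(E, η, X))` for all other cases. Further, if the `p`-adic
  representation `Gal(ℚ̄/ℚ) → GL_{ℤ_p}(T)` on the automorphism group of the `p`-adic Tate module `T`
  is surjective, we can take `n = 0`." (proof: Prop. 7.17 (Kurihara, `𝐇²(T) ≅ X^0`), Thm. 7.18 = [Ka,
  Thm. 12.5], and the exact sequences of Prop. 7.19, using Prop. 7.3 (`Col♭` surjective) and Prop. 7.6
  (`ε_1 Col♯` surjective; `Im ε_η Col♯ = J^η` for `η ≠ 1`, `J = (a_p + a_pX + (a_p/p)X², X)`).)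
  AT `η = 1` THE «other cases» CLAUSE APPLIES FOR BOTH COLOURS AND EVERY SUPERSINGULAR `a_p`: no
  `1/X` over `ℚ_∞` (the `1/X` sits on `♯` = Kobayashi's `−` at NON-trivial tame characters only, as in
  Kobayashi's Thm. 4.1 "`Char(X^-(E/K_∞)^η) ⊇ (pⁿ X⁻¹ L_p^-(E, η, X))` for `η ≠ 1`", quoted in
  `Kobayashi2003/SignedKatoDivisibility.lean`). Clean restatement at `η = 1`: Lei–Sujatha, Proc. AMS (2021)
  = arXiv:2103.06150 §1 (`paper:arxiv-2103.06150` p0003 L31–L58): "(Sp) `Char_Λ Sel^⋆(E/ℚ_cyc)^∨ =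
  (L_p^⋆(E))`", "`(L_p^⋆(E)) ⊂ Char_Λ Sel^⋆(E/ℚ_cyc)^∨` … if … surjective, then we may take `n = 0`".

## Transcription (tree vocabulary only; nothing re-declared)

* SETTING = the one of `Sprung2012.thm22_exists_isHondaSystem` / `Sprung2024.sec52_…` /
  `Sprung2024.lem59_…` word for word, so that consumers chain the facts: `W/ℚ` elliptic, globally
  minimal (`a_p = W.frobeniusTrace p`); "`p` odd supersingular" = `p ≠ 2`, `W.HasGoodReductionAtPrime p`,
  `(p : ℤ) ∣ W.frobeniusTrace p`; the cyclotomic `ℤ_p`-extension `κ` (`κ.IsCyclotomic`) with topological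
  generator `γ` normalised to the cyclotomic variable (`κ.IsTopGenerator γ`, `IsCyclotomicVariable p γ`:
  "fix a topological generator `γ` of `Γ`. By sending `γ` to `(1 + X)` …", p. 1486); the place
  `v ∣ p` with completion `ℚ_p = v.adicCompletion ℚ` and embedding `closureEmb`, a local lift `g` of
  `γ`, a Honda system `(cneg, c)` (`Sprung2012.IsHondaSystem`; existence = the fact
  `thm22_exists_isHondaSystem`) — the data through which `Sel^•` and `X^•` are DEFINED in
  `SharpFlatSelmer.lean`.
* "`L^∗_p(E, X)`" = the `•`-member `Sprung2017.chromaticL • L♯ L♭` of ANY Sprung pair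
  `Sprung2017.IsSprungPair f p (a_p) L♯ L♭` for the newform `f` of `W` (`IsNewformOf W f`): Sprung's
  `(L♯_p, L♭_p)` IS characterised by these Mazur–Tate congruences (Def. 6.1 with Prop. 6.3–6.5 here;
  Sprung 2017 Cor. 4.4–4.5) and the pair is UNIQUE at a supersingular prime (tree theorem
  `Sprung2017.IsSprungPair.unique`), so "for every Sprung pair" speaks about Sprung's functions
  themselves; existence is the PROVED tree theorem `Sprung2017.thm112_exists_isSprungPair_holds`.
  "chosen so that `L^∗_p ≠ 0`" = the hypothesis `chromaticL • L♯ L♭ ≠ 0`.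
* "`X^∗(E/ℚ_∞)`" = ANY datum `D : Sprung2012.SharpFlatSelmerDualData W κ γ (closureEmb _) (a_p) g c •`
  (such data EXIST: `Sprung2012.nonempty_sharpFlatSelmerDualData`); "finitely generated torsion
  `ℤ_p[[X]]`-module" = `Module.Finite (IwasawaAlgebra p) D.X ∧ Module.IsTorsion (IwasawaAlgebra p) D.X`;
  "`Char`" = `D.charIdeal`; "`⊇ (pⁿ L)`" = `(p : Λ)^n * L ∈ D.charIdeal`; "`Gal(ℚ̄/ℚ) → GL_{ℤ_p}(T)`
  surjective" = surjective modulo `p^m` for every `m` (`W.HasSurjectiveModNGaloisRep (p ^ m)`), as in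
  `Kobayashi2003.thm41_signedCharIdeal_divisibility`. In Thm. 7.16 the torsion-ness of `X^•` (which
  print obtains from Thm. 7.14 under the same hypothesis `L^• ≠ 0`) is DISPLAYED as a hypothesis, as the
  sibling Kobayashi binder does — WEAKER-by-binder, discharged by `of_thm714`.
* PERIOD NORMALISATION (flag `Sp12-716-period`; the same remark as in the sibling files
  `Kobayashi2003/SignedKatoDivisibility.lean`, `Sprung2017/SharpFlatPAdicLFunction.lean`): Sprung's
  `L^{♯/♭}_p(E, X)` are Néron-normalised (`Ω_E^±`, Def. 6.1–6.2), the tree's Sprung pairs by `Ω⁺_f`; at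
  an odd supersingular prime (`E[p]` irreducible, Manin constant and isogeny degrees prime to `p`) the
  two differ by a `p`-adic unit (neither `(pⁿ L) ⊆ Char` nor the Iwasawa invariants change); consumers
  needing Néron periods on the nose use the route's ratio `ϖ` as `Supersingular.KobayashiMainConjecture`.
* Thm. 1.4's "Suppose `E/ℚ` does not have complex multiplication" is implied by its surjectivity
  hypothesis (and automatic for `a_p ≠ 0`, Rem. 7.23); Thm. 7.16 prints only the surjectivity —
  transcribed as in Thm. 7.16 (no separate no-CM binder).
* NOT transcribed: the components `η ≠ 1` (the `1/X`-clause, the ideal `J`; the tree's ♯/♭ vocabulary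
  is the `η = 1` / `ℤ_p`-tower form); Main Conj. 1.3 / 7.21, Conj. 7.15 (conjectures); Prop. 7.17–7.20
  (Kato's `𝐇^i(T)`, `Z(T)`: skeleton binders only, `Kato2004/*`); `p = 2` (§7 assumes `p` odd).

## Contents

* `thm714_sharpFlatSelmerDual_finite_torsion` — NAMED FACT (Thm. 1.2 = Thm. 7.14 at `η = 1`);
  corollaries `.moduleFinite`, `.isTorsion`;
* `thm716_sharpFlatCharIdeal_divisibility` — NAMED FACT (Thm. 7.16 at `η = 1`, both clauses; Thm. 1.4
  is its second clause); corollaries `.rational` (`pⁿ L^• ∈ Char X^•`), `.integral` (`L^• ∈ Char X^•`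
  under surjectivity), `.dvd_of_charIdeal_eq_span` (for `Char X^• = (ξ)`: **`ξ ∣ L^•`** — the body of
  the route's displayed upper divisibility), `.exists_dvd_pow_mul` (`ξ ∣ pⁿ L^•`), `.of_thm714`
  (torsion hypotheses discharged by Thm. 7.14), the non-vacuity `.exists_datum_dvd` (granted both facts,
  for `L^• ≠ 0` there ARE `D`, `ξ`, `n` with `Char X^• = (ξ)`, `ξ ∣ pⁿ L^•`).
`Sprung2024.sec52_sharpFlatSelmerDual_finite_torsion` (seat kdot-split) is the printed COROLLARY of
Thm. 7.14 at analytic rank `0` for BOTH colours (Sprung 2024 Rem. 5.4, via `L♯(0) ≠ 0 ≠ L♭(0)`); the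
constant-term bridge lives Summits-side (`Supersingular.constantCoeff_chromaticL_of_isSprungPair`).

## References
* [Sprung2012] J. Number Theory 132 (2012): §1 p. 1486 (Thm. 1.2, Main Conj. 1.3, Thm. 1.4); Prop. 6.14
  (p. 1498); Def. 7.9, 7.11 (p. 1503); Thm. 7.14, 7.16, Prop. 7.17, Thm. 7.18 (p. 1504); Prop. 7.19,
  Main Conj. 7.21, Rem. 7.23 (p. 1505); clean-glyph controls arXiv:0903.3419v1 Thm. 57 / Main Conj. 60
  and J. reine angew. Math. 681 (2013) = arXiv:1106.1936, §1 and Prop. 19.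
* [Kobayashi2003] Invent. Math. 152 (2003), Thm. 1.3 / 4.1 (the `a_p = 0` case), Prop. 7.1, Cor. 7.2.
* [Kato2004Asterisque] Astérisque 295 (2004), Thm. 12.5. [LeiSujatha2021] Proc. AMS (2021),
  doi:10.1090/proc/15480, §1 (Sp). [Sprung2017] ANT 11 (2017), Thm. 1.12, Cor. 4.4–4.5.
  [Sprung2024] Adv. Math. 449 (2024) 109741, §1 p. 4 and Remark 5.4.
* Cell documents: `run/shared/lean/pub/bsd-littype/OPEN-QUESTIONS-11.md` §D Q-J5 (the `1/X` colour);
  `…/staging/bsd-littype-11/SHARPFLAT-PROGRAMME.md` (unit U7).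
-/

noncomputable section

open scoped Classical NumberField MatrixGroups ModularForm

open NumberField IsDedekindDomain WeierstrassCurve CongruenceSubgroup
  Literature.NumberTheory.EllipticCurves Literature.NumberTheory.EllipticCurves.ModularForms
  Literature.NumberTheory.EllipticCurves.ZpExtension Literature.NumberTheory.EllipticCurves.Sprung2017

namespace Literature.NumberTheory.EllipticCurves.Sprung2012

/-! ### Theorem 1.2 = Theorem 7.14 (`η = 1`) -/

/-- **Sprung 2012, Theorem 1.2 (= Theorem 7.14 at the trivial tame character): for the colour `•`
with `L^•_p(E, X) ≠ 0`, `X^•(E/ℚ_∞)` is a finitely generated torsion `Λ`-module.** Printed (p. 1486):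
"Choose `∗ ∈ {♯, ♭}` so that `L^∗_p(E, X)` is nonzero. The Pontryagin dual
`X^∗(E/ℚ_∞) = Hom(Sel^∗(E/ℚ_∞), ℚ_p/ℤ_p)` of this `∗`-Selmer group is a finitely generated torsion
`ℤ_p[[X]]`-module." (Thm. 7.14, p. 1504: "Let `p` be an odd supersingular prime, `η : Δ → ℤ_p^×`
be a character, and `∗ ∈ {♯, ♭}` be chosen so that `L^∗_p(E, η, X) ≠ 0`. Then `X^∗(E/K_∞)^η` is
`ℤ_p[[X]]`-torsion.") TRANSCRIBED (module docstring, "Transcription"): in the setting of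
`thm22_exists_isHondaSystem` (`W/ℚ` elliptic, globally minimal; `p ≠ 2` of good reduction with
`p ∣ a_p`; cyclotomic `(κ, γ)` with `IsCyclotomicVariable p γ`; the place `v ∣ p`, a local lift `g` of
`γ`, a Honda system `(cneg, c)`), for the newform `f` of `W`, every colour `•`, every Sprung pair
`(L♯, L♭)` for `a_p` (`Sprung2017.IsSprungPair`) with `L^• = chromaticL • L♯ L♭ ≠ 0`, and every dual
datum `D` of `Sel^•(E/ℚ_∞)`: `D.X` is `Module.Finite` and `Module.IsTorsion` over `Λ = ℤ_p⟦T⟧`. The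
`η ≠ 1` components are NOT transcribed. Nothing is asserted: users take
`(h : thm714_sharpFlatSelmerDual_finite_torsion)`; no `_holds` is expected.
[cite: Sprung2012, Thm. 1.2 (p. 1486) and Thm. 7.14 (p. 1504); corpus `paper:doi-10-1016-j-jnt-2011-11-003` p0004 L31–L32, p0022 L12–L36] -/
def thm714_sharpFlatSelmerDual_finite_torsion : Prop :=
  ∀ (W : WeierstrassCurve ℚ) [W.IsElliptic] [W.IsGloballyMinimal] (p : ℕ) [Fact p.Prime],
    p ≠ 2 → W.HasGoodReductionAtPrime p → (p : ℤ) ∣ W.frobeniusTrace p →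
    ∀ {N : ℕ} [NeZero N] (f : CuspForm (Gamma0 N) 2), IsNewformOf W f →
    ∀ (κ : ZpExtension ℚ p) (γ : Field.absoluteGaloisGroup ℚ),
      κ.IsCyclotomic → κ.IsTopGenerator γ → IsCyclotomicVariable p γ →
    ∀ (v : HeightOneSpectrum (𝓞 ℚ)), (p : 𝓞 ℚ) ∈ v.asIdeal →
    ∀ (g : Field.absoluteGaloisGroup (v.adicCompletion ℚ)),
      κ.IsTopGenerator (resGalOfEmb (closureEmb (K := ℚ) (v.adicCompletion ℚ)) g) →
    ∀ (cneg : localPoints W (v.adicCompletion ℚ)) (c : ℕ → localPoints W (v.adicCompletion ℚ)),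
      IsHondaSystem κ (closureEmb (K := ℚ) (v.adicCompletion ℚ)) W (W.frobeniusTrace p) g cneg c →
    ∀ (col : Chroma) (Lsharp Lflat : IwasawaAlgebra p),
      IsSprungPair f p (W.frobeniusTrace p) Lsharp Lflat → chromaticL col Lsharp Lflat ≠ 0 →
    ∀ (D : SharpFlatSelmerDualData W κ γ (closureEmb (K := ℚ) (v.adicCompletion ℚ))
        (W.frobeniusTrace p) g c col),
      Module.Finite (IwasawaAlgebra p) D.X ∧ Module.IsTorsion (IwasawaAlgebra p) D.X

namespace thm714_sharpFlatSelmerDual_finite_torsion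

variable {W : WeierstrassCurve ℚ} [W.IsElliptic] [W.IsGloballyMinimal] {p : ℕ} [Fact p.Prime]
  {N : ℕ} [NeZero N] {f : CuspForm (Gamma0 N) 2}
  {κ : ZpExtension ℚ p} {γ : Field.absoluteGaloisGroup ℚ} {v : HeightOneSpectrum (𝓞 ℚ)}
  {g : Field.absoluteGaloisGroup (v.adicCompletion ℚ)}
  {cneg : localPoints W (v.adicCompletion ℚ)} {c : ℕ → localPoints W (v.adicCompletion ℚ)}
  {col : Chroma} {Lsharp Lflat : IwasawaAlgebra p}

/-- First half of Thm. 1.2 / 7.14 as a function of the fact: `X^•(E/ℚ_∞)` is a finitely generated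
`Λ`-module. [cite: Sprung2012, Thm. 1.2 (p. 1486)] -/
theorem moduleFinite (h : thm714_sharpFlatSelmerDual_finite_torsion) (hp : p ≠ 2)
    (hgood : W.HasGoodReductionAtPrime p) (hss : (p : ℤ) ∣ W.frobeniusTrace p) (hf : IsNewformOf W f)
    (hκ : κ.IsCyclotomic) (hγ : κ.IsTopGenerator γ) (hγ' : IsCyclotomicVariable p γ)
    (hv : (p : 𝓞 ℚ) ∈ v.asIdeal)
    (hg : κ.IsTopGenerator (resGalOfEmb (closureEmb (K := ℚ) (v.adicCompletion ℚ)) g))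
    (hH : IsHondaSystem κ (closureEmb (K := ℚ) (v.adicCompletion ℚ)) W (W.frobeniusTrace p) g cneg c)
    (hL : IsSprungPair f p (W.frobeniusTrace p) Lsharp Lflat) (hL0 : chromaticL col Lsharp Lflat ≠ 0)
    (D : SharpFlatSelmerDualData W κ γ (closureEmb (K := ℚ) (v.adicCompletion ℚ))
      (W.frobeniusTrace p) g c col) :
    Module.Finite (IwasawaAlgebra p) D.X :=
  (h W p hp hgood hss f hf κ γ hκ hγ hγ' v hv g hg cneg c hH col Lsharp Lflat hL hL0 D).1

/-- Second half of Thm. 1.2 / 7.14 as a function of the fact: `X^•(E/ℚ_∞)` is a torsion `Λ`-module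
("`Sel^•(E/ℚ_∞)` is `Λ`-cotorsion"). [cite: Sprung2012, Thm. 1.2 (p. 1486) and Thm. 7.14 (p. 1504)] -/
theorem isTorsion (h : thm714_sharpFlatSelmerDual_finite_torsion) (hp : p ≠ 2)
    (hgood : W.HasGoodReductionAtPrime p) (hss : (p : ℤ) ∣ W.frobeniusTrace p) (hf : IsNewformOf W f)
    (hκ : κ.IsCyclotomic) (hγ : κ.IsTopGenerator γ) (hγ' : IsCyclotomicVariable p γ)
    (hv : (p : 𝓞 ℚ) ∈ v.asIdeal)
    (hg : κ.IsTopGenerator (resGalOfEmb (closureEmb (K := ℚ) (v.adicCompletion ℚ)) g))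
    (hH : IsHondaSystem κ (closureEmb (K := ℚ) (v.adicCompletion ℚ)) W (W.frobeniusTrace p) g cneg c)
    (hL : IsSprungPair f p (W.frobeniusTrace p) Lsharp Lflat) (hL0 : chromaticL col Lsharp Lflat ≠ 0)
    (D : SharpFlatSelmerDualData W κ γ (closureEmb (K := ℚ) (v.adicCompletion ℚ))
      (W.frobeniusTrace p) g c col) :
    Module.IsTorsion (IwasawaAlgebra p) D.X :=
  (h W p hp hgood hss f hf κ γ hκ hγ hγ' v hv g hg cneg c hH col Lsharp Lflat hL hL0 D).2

end thm714_sharpFlatSelmerDual_finite_torsion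

/-! ### Theorem 1.4 / Theorem 7.16 (`η = 1`): the Kato-side inclusion -/

/-- **Sprung 2012, Theorem 7.16 at the trivial tame character (its `n = 0` clause is Theorem 1.4):
the Kato-side inclusion `Char X^•(E/ℚ_∞) ⊇ (pⁿ L^•_p(E, X))` — a THEOREM of the source (proved from
Kato's Euler system, Thm. 7.18 = [Ka, Thm. 12.5], through Kurihara's Prop. 7.17 and the exact sequences
of Prop. 7.19).** Printed (p. 1504): "Let `p` be an odd supersingular prime, and `∗ ∈ {♯, ♭}` so that
`L^∗_p(E, η, X) ≠ 0`. Then for some integer `n ⩾ 0`, `Char X^∗(E/K_∞)^η ⊇ (pⁿ (1/X) L^∗_p(E, η, X))`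
if `∗ = ♯`, `η ≠ 1`, and `a_p = 0`, `Char X^∗(E/K_∞)^η ⊇ (pⁿ L^∗_p(E, η, X))` for all other cases.
Further, if the `p`-adic representation `Gal(ℚ̄/ℚ) → GL_{ℤ_p}(T)` on the automorphism group of the
`p`-adic Tate module `T` is surjective, we can take `n = 0`." — and p. 1486, Theorem 1.4: "Suppose
`E/ℚ` does not have complex multiplication. Choose `∗ ∈ {♯, ♭}` so that `L^∗_p(E, X)` is nonzero. Then
if the `p`-adic representation `Gal(ℚ̄/ℚ) → GL_{ℤ_p}(T)` … is surjective, we have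
`Char(X^∗(E/ℚ_∞)) ⊇ (L^∗_p(E, X))`." At `η = 1` (the `ℚ_∞`-object) the "other cases" clause applies
for both colours and every supersingular `a_p`: NO `1/X`. TRANSCRIBED (module docstring,
"Transcription"; shape of `Kobayashi2003.thm41_signedCharIdeal_divisibility`): in the setting of
`thm714_sharpFlatSelmerDual_finite_torsion`, for every colour `•`, every Sprung pair `(L♯, L♭)` for
`a_p` with `L^• ≠ 0`, and every dual datum `D` of `Sel^•(E/ℚ_∞)` whose module `D.X` is finitely
generated and `Λ`-torsion (Thm. 7.14, displayed): (a) `pⁿ · L^• ∈ Char(X^•) = D.charIdeal` for some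
`n ≥ 0`; (b) if `ρ_{E,p^∞} : Gal(ℚ̄/ℚ) → GL₂(ℤ_p)` is surjective (surjective mod `p^m` for every `m`),
then `L^• ∈ Char(X^•)`. Period normalisation: flag `Sp12-716-period` (module docstring). The `η ≠ 1`
components, the converse inclusion (Main Conj. 1.3 / 7.21) and the comparison with Kato's formulation
are NOT asserted. Nothing is asserted: users take `(h : thm716_sharpFlatCharIdeal_divisibility)`; no
`_holds` is expected.

KEYING CAVEAT (recorded 2026-08-28; x8 dossier T67 (m) / T69 (d) / T70 (b), cell referee R-250 / R-271 /
R-275, director-bsd (266) R1′; TYPED ≠ PRINTED here — do not cite this constant as Sprung's Thm. 7.16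
without the involution). The dual datum `D : SharpFlatSelmerDualData W κ γ …` below carries the SAME key `γ`
as the cyclotomic variable of `L^•_p(E, X)` (`IsCyclotomicVariable p γ`, `1 + X ↦ γ`). Under the tree's
Pontryagin-dual convention (`SharpFlatSelmerDualData.toDual_T_smul`: `T` acts on the dual by PRE-composition with
`conj_γ`, i.e. by the contragredient action of `γ⁻¹`) the printed `X^•(E/ℚ_∞)` of [Sprung2012] Def. 7.11 /
Thm. 7.16 (pp. 1503–1504) — the Pontryagin dual with its NATURAL `Λ`-action (cf. [Greenberg1989]
pp. 101–102 `S^ι`; [Nekovar2006] 8.9.6.1–2, (9.1.4.2) and p. 263; [PerrinRiou1995Asterisque] §2.5.1, A.3.2)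
— is the datum of key `γ⁻¹`, and `D` of key `γ` is its involution twist `(X^•)^ι`. So (a) reads
«`pⁿ · L^• ∈ Char((X^•)^ι)`», i.e. «`pⁿ · ι(L^•) ∈ Char X^•`», against print's «`Char X^• ⊇ (pⁿ L^•)`»; the two
agree iff `Char X^•` is `ι`-symmetric — true up to units at `a_p = 0`
(`Sprung2017.cor414_sharpFlat_functionalEquation_apZero_holds`; compare
`Kobayashi2003.thm41_signedCharIdeal_divisibility`), unprinted at `(p, a_p) = (3, ±3)`, where the cell's
referee and vet read this typing as failing in nature at every X8 pair whose `L^•` has an `ι`-unpaired zero off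
`(p), (X)` (statement-level findings R-250 §1–§3, not kernel theorems). The PRINT-KEYED transcription
(`D : SharpFlatSelmerDualData W κ γ⁻¹ …`, everything else unchanged) is
`thm716_sharpFlatCharIdeal_divisibility_contra` in `Sprung2012/SharpFlatColemanKatoContragredient.lean` (module
docstring: the comparison; `.invol_rational` / `.invol_integral`: its reading on data of key `γ`); the kernel
dictionary is `Sprung2012/SharpFlatSelmerDualInvolutionTwistProofs.lean`
(`sharpFlatSelmerDualData_mem_charIdeal_inv_iff`: `f ∈ char D.X ↔ ι f ∈ char D₀.X`). The displayed torsion /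
finite-generation hypotheses and `thm714_sharpFlatSelmerDual_finite_torsion` (above) are keying-IMMUNE
(`…_finite_inv_iff`, `…_isTorsion_inv_iff`). Kept unchanged for its consumers (route items binding it by name,
e.g. conjunct (5) of `PublishedInputsX8Core`); a print-keyed consumer should bind the `_contra` sibling, as the
re-keyed guard `HeldFactsKatoSporadicX8C` of route `PrintX8VS` does.
[cite: Sprung2012, Thm. 7.16 (p. 1504) and Thm. 1.4 (p. 1486); corpus `paper:doi-10-1016-j-jnt-2011-11-003` p0022 L40–L75, p0004 L46–L57; clean glyphs arXiv:0903.3419v1 Thm. 57, arXiv:1106.1936 Prop. 19] [cite: LeiSujatha2021, §1 (Sp) and the sentence on Kato's inclusion with `n = 0`] -/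
def thm716_sharpFlatCharIdeal_divisibility : Prop :=
  ∀ (W : WeierstrassCurve ℚ) [W.IsElliptic] [W.IsGloballyMinimal] (p : ℕ) [Fact p.Prime],
    p ≠ 2 → W.HasGoodReductionAtPrime p → (p : ℤ) ∣ W.frobeniusTrace p →
    ∀ {N : ℕ} [NeZero N] (f : CuspForm (Gamma0 N) 2), IsNewformOf W f →
    ∀ (κ : ZpExtension ℚ p) (γ : Field.absoluteGaloisGroup ℚ),
      κ.IsCyclotomic → κ.IsTopGenerator γ → IsCyclotomicVariable p γ →
    ∀ (v : HeightOneSpectrum (𝓞 ℚ)), (p : 𝓞 ℚ) ∈ v.asIdeal →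
    ∀ (g : Field.absoluteGaloisGroup (v.adicCompletion ℚ)),
      κ.IsTopGenerator (resGalOfEmb (closureEmb (K := ℚ) (v.adicCompletion ℚ)) g) →
    ∀ (cneg : localPoints W (v.adicCompletion ℚ)) (c : ℕ → localPoints W (v.adicCompletion ℚ)),
      IsHondaSystem κ (closureEmb (K := ℚ) (v.adicCompletion ℚ)) W (W.frobeniusTrace p) g cneg c →
    ∀ (col : Chroma) (Lsharp Lflat : IwasawaAlgebra p),
      IsSprungPair f p (W.frobeniusTrace p) Lsharp Lflat → chromaticL col Lsharp Lflat ≠ 0 →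
    ∀ (D : SharpFlatSelmerDualData W κ γ (closureEmb (K := ℚ) (v.adicCompletion ℚ))
        (W.frobeniusTrace p) g c col) [Module.Finite (IwasawaAlgebra p) D.X],
      Module.IsTorsion (IwasawaAlgebra p) D.X →
      (∃ n : ℕ, (p : IwasawaAlgebra p) ^ n * chromaticL col Lsharp Lflat ∈ D.charIdeal) ∧
      ((∀ m : ℕ, W.HasSurjectiveModNGaloisRep (p ^ m : ℕ)) →
        chromaticL col Lsharp Lflat ∈ D.charIdeal)

namespace thm716_sharpFlatCharIdeal_divisibility

variable {W : WeierstrassCurve ℚ} [W.IsElliptic] [W.IsGloballyMinimal] {p : ℕ} [Fact p.Prime]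
  {N : ℕ} [NeZero N] {f : CuspForm (Gamma0 N) 2}
  {κ : ZpExtension ℚ p} {γ : Field.absoluteGaloisGroup ℚ} {v : HeightOneSpectrum (𝓞 ℚ)}
  {g : Field.absoluteGaloisGroup (v.adicCompletion ℚ)}
  {cneg : localPoints W (v.adicCompletion ℚ)} {c : ℕ → localPoints W (v.adicCompletion ℚ)}
  {col : Chroma} {Lsharp Lflat : IwasawaAlgebra p}

/-- Thm. 7.16, first display at `η = 1`, as a function of the fact: **`pⁿ L^•_p(E, X) ∈ Char(X^•)`
for some `n ≥ 0`** (no hypothesis on the Galois image). [cite: Sprung2012, Thm. 7.16 (p. 1504)] -/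
theorem rational (h : thm716_sharpFlatCharIdeal_divisibility) (hp : p ≠ 2)
    (hgood : W.HasGoodReductionAtPrime p) (hss : (p : ℤ) ∣ W.frobeniusTrace p) (hf : IsNewformOf W f)
    (hκ : κ.IsCyclotomic) (hγ : κ.IsTopGenerator γ) (hγ' : IsCyclotomicVariable p γ)
    (hv : (p : 𝓞 ℚ) ∈ v.asIdeal)
    (hg : κ.IsTopGenerator (resGalOfEmb (closureEmb (K := ℚ) (v.adicCompletion ℚ)) g))
    (hH : IsHondaSystem κ (closureEmb (K := ℚ) (v.adicCompletion ℚ)) W (W.frobeniusTrace p) g cneg c)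
    (hL : IsSprungPair f p (W.frobeniusTrace p) Lsharp Lflat) (hL0 : chromaticL col Lsharp Lflat ≠ 0)
    (D : SharpFlatSelmerDualData W κ γ (closureEmb (K := ℚ) (v.adicCompletion ℚ))
      (W.frobeniusTrace p) g c col) [Module.Finite (IwasawaAlgebra p) D.X]
    (hX : Module.IsTorsion (IwasawaAlgebra p) D.X) :
    ∃ n : ℕ, (p : IwasawaAlgebra p) ^ n * chromaticL col Lsharp Lflat ∈ D.charIdeal :=
  (h W p hp hgood hss f hf κ γ hκ hγ hγ' v hv g hg cneg c hH col Lsharp Lflat hL hL0 D hX).1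

/-- Thm. 7.16, last sentence (= Thm. 1.4), as a function of the fact: **if `ρ_{E,p^∞}` is surjective
then `L^•_p(E, X) ∈ Char(X^•)`** ("we can take `n = 0`"). [cite: Sprung2012, Thm. 1.4 (p. 1486) and Thm. 7.16 (p. 1504)] -/
theorem integral (h : thm716_sharpFlatCharIdeal_divisibility) (hp : p ≠ 2)
    (hgood : W.HasGoodReductionAtPrime p) (hss : (p : ℤ) ∣ W.frobeniusTrace p) (hf : IsNewformOf W f)
    (hκ : κ.IsCyclotomic) (hγ : κ.IsTopGenerator γ) (hγ' : IsCyclotomicVariable p γ)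
    (hv : (p : 𝓞 ℚ) ∈ v.asIdeal)
    (hg : κ.IsTopGenerator (resGalOfEmb (closureEmb (K := ℚ) (v.adicCompletion ℚ)) g))
    (hH : IsHondaSystem κ (closureEmb (K := ℚ) (v.adicCompletion ℚ)) W (W.frobeniusTrace p) g cneg c)
    (hL : IsSprungPair f p (W.frobeniusTrace p) Lsharp Lflat) (hL0 : chromaticL col Lsharp Lflat ≠ 0)
    (D : SharpFlatSelmerDualData W κ γ (closureEmb (K := ℚ) (v.adicCompletion ℚ))
      (W.frobeniusTrace p) g c col) [Module.Finite (IwasawaAlgebra p) D.X]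
    (hX : Module.IsTorsion (IwasawaAlgebra p) D.X)
    (hsurj : ∀ m : ℕ, W.HasSurjectiveModNGaloisRep (p ^ m : ℕ)) :
    chromaticL col Lsharp Lflat ∈ D.charIdeal :=
  (h W p hp hgood hss f hf κ γ hκ hγ hγ' v hv g hg cneg c hH col Lsharp Lflat hL hL0 D hX).2 hsurj

/-- **(MC↑•) in the route's binder shape.** For a characteristic power series `ξ^•` of `X^•(E/ℚ_∞)`
(`Char(X^•) = (ξ^•)`) and `ρ_{E,p^∞}` surjective: **`ξ^• ∣ L^•_p(E, X)` in `Λ`**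
(`Ideal.mem_span_singleton`). [cite: Sprung2012, Thm. 7.16 (p. 1504)] -/
theorem dvd_of_charIdeal_eq_span (h : thm716_sharpFlatCharIdeal_divisibility) (hp : p ≠ 2)
    (hgood : W.HasGoodReductionAtPrime p) (hss : (p : ℤ) ∣ W.frobeniusTrace p) (hf : IsNewformOf W f)
    (hκ : κ.IsCyclotomic) (hγ : κ.IsTopGenerator γ) (hγ' : IsCyclotomicVariable p γ)
    (hv : (p : 𝓞 ℚ) ∈ v.asIdeal)
    (hg : κ.IsTopGenerator (resGalOfEmb (closureEmb (K := ℚ) (v.adicCompletion ℚ)) g))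
    (hH : IsHondaSystem κ (closureEmb (K := ℚ) (v.adicCompletion ℚ)) W (W.frobeniusTrace p) g cneg c)
    (hL : IsSprungPair f p (W.frobeniusTrace p) Lsharp Lflat) (hL0 : chromaticL col Lsharp Lflat ≠ 0)
    (D : SharpFlatSelmerDualData W κ γ (closureEmb (K := ℚ) (v.adicCompletion ℚ))
      (W.frobeniusTrace p) g c col) [Module.Finite (IwasawaAlgebra p) D.X]
    (hX : Module.IsTorsion (IwasawaAlgebra p) D.X)
    (hsurj : ∀ m : ℕ, W.HasSurjectiveModNGaloisRep (p ^ m : ℕ))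
    {ξ : IwasawaAlgebra p} (hξ : D.charIdeal = Ideal.span {ξ}) : ξ ∣ chromaticL col Lsharp Lflat := by
  have hmem := integral h hp hgood hss hf hκ hγ hγ' hv hg hH hL hL0 D hX hsurj
  rw [hξ] at hmem
  exact Ideal.mem_span_singleton.mp hmem

/-- The rational form in the binder shape: for `Char(X^•) = (ξ^•)`, **`ξ^• ∣ pⁿ L^•_p(E, X)` for some
`n ≥ 0`**, with no hypothesis on the Galois image. [cite: Sprung2012, Thm. 7.16 (p. 1504)] -/
theorem exists_dvd_pow_mul (h : thm716_sharpFlatCharIdeal_divisibility) (hp : p ≠ 2)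
    (hgood : W.HasGoodReductionAtPrime p) (hss : (p : ℤ) ∣ W.frobeniusTrace p) (hf : IsNewformOf W f)
    (hκ : κ.IsCyclotomic) (hγ : κ.IsTopGenerator γ) (hγ' : IsCyclotomicVariable p γ)
    (hv : (p : 𝓞 ℚ) ∈ v.asIdeal)
    (hg : κ.IsTopGenerator (resGalOfEmb (closureEmb (K := ℚ) (v.adicCompletion ℚ)) g))
    (hH : IsHondaSystem κ (closureEmb (K := ℚ) (v.adicCompletion ℚ)) W (W.frobeniusTrace p) g cneg c)
    (hL : IsSprungPair f p (W.frobeniusTrace p) Lsharp Lflat) (hL0 : chromaticL col Lsharp Lflat ≠ 0)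
    (D : SharpFlatSelmerDualData W κ γ (closureEmb (K := ℚ) (v.adicCompletion ℚ))
      (W.frobeniusTrace p) g c col) [Module.Finite (IwasawaAlgebra p) D.X]
    (hX : Module.IsTorsion (IwasawaAlgebra p) D.X)
    {ξ : IwasawaAlgebra p} (hξ : D.charIdeal = Ideal.span {ξ}) :
    ∃ n : ℕ, ξ ∣ (p : IwasawaAlgebra p) ^ n * chromaticL col Lsharp Lflat := by
  obtain ⟨n, hmem⟩ := rational h hp hgood hss hf hκ hγ hγ' hv hg hH hL hL0 D hX
  rw [hξ] at hmem
  exact ⟨n, Ideal.mem_span_singleton.mp hmem⟩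

/-- **Thm. 7.16 with the torsion hypotheses discharged by Thm. 7.14** (both facts granted): for the
colour `•` with `L^• ≠ 0` and ANY datum `D` of `Sel^•(E/ℚ_∞)`, (a) `pⁿ L^• ∈ Char(X^•)` for some `n`,
and (b) `L^• ∈ Char(X^•)` under surjectivity of `ρ_{E,p^∞}` — the printed form of Thm. 7.16 / 1.4
(the hypothesis `L^∗_p ≠ 0` alone). [cite: Sprung2012, Thm. 1.2 and Thm. 1.4 (p. 1486), Thm. 7.14 and Thm. 7.16 (p. 1504)] -/
theorem of_thm714 (h : thm716_sharpFlatCharIdeal_divisibility)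
    (h714 : thm714_sharpFlatSelmerDual_finite_torsion) (hp : p ≠ 2)
    (hgood : W.HasGoodReductionAtPrime p) (hss : (p : ℤ) ∣ W.frobeniusTrace p) (hf : IsNewformOf W f)
    (hκ : κ.IsCyclotomic) (hγ : κ.IsTopGenerator γ) (hγ' : IsCyclotomicVariable p γ)
    (hv : (p : 𝓞 ℚ) ∈ v.asIdeal)
    (hg : κ.IsTopGenerator (resGalOfEmb (closureEmb (K := ℚ) (v.adicCompletion ℚ)) g))
    (hH : IsHondaSystem κ (closureEmb (K := ℚ) (v.adicCompletion ℚ)) W (W.frobeniusTrace p) g cneg c)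
    (hL : IsSprungPair f p (W.frobeniusTrace p) Lsharp Lflat) (hL0 : chromaticL col Lsharp Lflat ≠ 0)
    (D : SharpFlatSelmerDualData W κ γ (closureEmb (K := ℚ) (v.adicCompletion ℚ))
      (W.frobeniusTrace p) g c col) :
    (∃ n : ℕ, (p : IwasawaAlgebra p) ^ n * chromaticL col Lsharp Lflat ∈ D.charIdeal) ∧
      ((∀ m : ℕ, W.HasSurjectiveModNGaloisRep (p ^ m : ℕ)) →
        chromaticL col Lsharp Lflat ∈ D.charIdeal) := by
  haveI : Module.Finite (IwasawaAlgebra p) D.X :=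
    h714.moduleFinite hp hgood hss hf hκ hγ hγ' hv hg hH hL hL0 D
  exact h W p hp hgood hss f hf κ γ hκ hγ hγ' v hv g hg cneg c hH col Lsharp Lflat hL hL0 D
    (h714.isTorsion hp hgood hss hf hκ hγ hγ' hv hg hH hL hL0 D)

/-- **Non-vacuity** (the two facts granted): for `γ` a topological generator and a colour `•` with
`L^• ≠ 0` there ARE a dual datum `D` of `Sel^•(E/ℚ_∞)` (`nonempty_sharpFlatSelmerDualData`, a
CONSTRUCTION), a characteristic power series `ξ^•` (`Char(X^•)` is principal: `charIdeal_isPrincipal_holds`,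
`Λ` a UFD) and an `n ≥ 0` with `ξ^• ∣ pⁿ L^•` in `Λ` — an actual instance of the route's displayed
upper divisibility, on Sprung's own `X^•`. (A Sprung pair with a non-zero member exists by the PROVED
`Sprung2017.thm112_exists_isSprungPair_holds` and `Sprung2017.IsSprungPair.ne_zero_or_ne_zero`; a Honda
system by the fact `thm22_exists_isHondaSystem`.) [cite: Sprung2012, Thm. 1.2 and Thm. 1.4 (p. 1486), Thm. 7.16 (p. 1504)] -/
theorem exists_datum_dvd (h : thm716_sharpFlatCharIdeal_divisibility)
    (h714 : thm714_sharpFlatSelmerDual_finite_torsion) (hp : p ≠ 2)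
    (hgood : W.HasGoodReductionAtPrime p) (hss : (p : ℤ) ∣ W.frobeniusTrace p) (hf : IsNewformOf W f)
    (hκ : κ.IsCyclotomic) (hγ : κ.IsTopGenerator γ) (hγ' : IsCyclotomicVariable p γ)
    (hv : (p : 𝓞 ℚ) ∈ v.asIdeal)
    (hg : κ.IsTopGenerator (resGalOfEmb (closureEmb (K := ℚ) (v.adicCompletion ℚ)) g))
    (hH : IsHondaSystem κ (closureEmb (K := ℚ) (v.adicCompletion ℚ)) W (W.frobeniusTrace p) g cneg c)
    (hL : IsSprungPair f p (W.frobeniusTrace p) Lsharp Lflat) (hL0 : chromaticL col Lsharp Lflat ≠ 0) :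
    ∃ (D : SharpFlatSelmerDualData W κ γ (closureEmb (K := ℚ) (v.adicCompletion ℚ))
        (W.frobeniusTrace p) g c col) (ξ : IwasawaAlgebra p) (n : ℕ),
      D.charIdeal = Ideal.span {ξ} ∧ ξ ∣ (p : IwasawaAlgebra p) ^ n * chromaticL col Lsharp Lflat := by
  obtain ⟨D⟩ := nonempty_sharpFlatSelmerDualData W κ (closureEmb (K := ℚ) (v.adicCompletion ℚ))
    (W.frobeniusTrace p) g c col hγ
  haveI : Module.Finite (IwasawaAlgebra p) D.X :=
    h714.moduleFinite hp hgood hss hf hκ hγ hγ' hv hg hH hL hL0 D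
  have hX : Module.IsTorsion (IwasawaAlgebra p) D.X :=
    h714.isTorsion hp hgood hss hf hκ hγ hγ' hv hg hH hL hL0 D
  obtain ⟨ξ, hξ⟩ := (charIdeal_isPrincipal_holds p D.X).principal
  have hξ' : D.charIdeal = Ideal.span {ξ} := hξ
  obtain ⟨n, hn⟩ := exists_dvd_pow_mul h hp hgood hss hf hκ hγ hγ' hv hg hH hL hL0 D hX hξ'
  exact ⟨D, ξ, n, hξ', hn⟩

end thm716_sharpFlatCharIdeal_divisibility

end Literature.NumberTheory.EllipticCurves.Sprung2012

end
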